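import Summits.Ventures.PercRepro.S1CellCapped
import Summits.Ventures.PercRepro.S1CoreCapAvg

/-!
# PercRepro — the cells `(11, 7)`, `(11, 8)`, `(10, 11)` modulo `Q*(3) = 5`, `Q*(4) = 8`, `Q*(5) = 11` (p2, gen 17)

The three capped cores of `S1CellCapped` with p1's averaging bounds (`S1CoreCapAvg`, INBOX 8541 / 8560):
`s₄ ≤ 73` at nullity `7`, `≤ 105` at `8`, `≤ 266 = avgBound 5` at `11` on every `e`-free core — all modulo exactly
the three computed instances `FourCapSpec capPaper 3 5`, `4 8`, `5 11` (RULING (um)(33): conditional). With LEMMA Q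
on the triangle side, the rows `10` and `11` of the `q = 4` window reduce, modulo these three Props, to the cells
`(10, 5 … 10)`, `(11, 5)` and `(11, 6)`.

* **`c025_core_eleven_seven_of_props`**, **`c025_core_eleven_eight_of_props`**, **`c025_core_ten_eleven_of_props`**.
Axioms: standard (the instances are hypotheses).
-/

open scoped Matroid

namespace PercRepro

namespace S1

open Set

variable {α : Type}

/-- **THE CELL `(11, 7)` MODULO THE THREE `FourCapSpec` INSTANCES.** -/
theorem c025_core_eleven_seven_of_props (M : Matroid α) [M.Finite] (hR : M.eRank = (11 : ℕ)) (hn : M.E.ncard = 18)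
    (hfree : ∀ e ∈ M.E, ∃ A ⊆ M.E \ {e}, e ∉ M.closure A ∧ e ∉ M.closure ((M.E \ {e}) \ A))
    (hQ3 : FourCap.FourCapSpec FourCap.capPaper 3 5) (hQ4 : FourCap.FourCapSpec FourCap.capPaper 4 8)
    (hQ5 : FourCap.FourCapSpec FourCap.capPaper 5 11) : ThmN.RLS M 11 4 := by
  have hd : M.E.encard = M.eRank + 7 := by
    rw [hR, ← M.ground_finite.cast_ncard_eq, hn]
    norm_num
  exact c025_core_eleven_seven_of_cap M hR hn hfree
    (ncard_fourCircuits_le_seventy_three M hfree hd hQ3 hQ4 hQ5)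

/-- **THE CELL `(11, 8)` MODULO THE THREE `FourCapSpec` INSTANCES.** -/
theorem c025_core_eleven_eight_of_props (M : Matroid α) [M.Finite] (hR : M.eRank = (11 : ℕ)) (hn : M.E.ncard = 19)
    (hfree : ∀ e ∈ M.E, ∃ A ⊆ M.E \ {e}, e ∉ M.closure A ∧ e ∉ M.closure ((M.E \ {e}) \ A))
    (hQ3 : FourCap.FourCapSpec FourCap.capPaper 3 5) (hQ4 : FourCap.FourCapSpec FourCap.capPaper 4 8)
    (hQ5 : FourCap.FourCapSpec FourCap.capPaper 5 11) : ThmN.RLS M 11 4 := by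
  have hd : M.E.encard = M.eRank + 8 := by
    rw [hR, ← M.ground_finite.cast_ncard_eq, hn]
    norm_num
  exact c025_core_eleven_eight_of_cap M hR hn hfree
    (ncard_fourCircuits_le_one_hundred_five M hfree hd hQ3 hQ4 hQ5)

/-- **THE CELL `(10, 11)` MODULO THE THREE `FourCapSpec` INSTANCES** (`avgBound 5 = 266`). -/
theorem c025_core_ten_eleven_of_props (M : Matroid α) [M.Finite] (hR : M.eRank = (10 : ℕ)) (hn : M.E.ncard = 21)
    (hfree : ∀ e ∈ M.E, ∃ A ⊆ M.E \ {e}, e ∉ M.closure A ∧ e ∉ M.closure ((M.E \ {e}) \ A))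
    (hQ3 : FourCap.FourCapSpec FourCap.capPaper 3 5) (hQ4 : FourCap.FourCapSpec FourCap.capPaper 4 8)
    (hQ5 : FourCap.FourCapSpec FourCap.capPaper 5 11) : ThmN.RLS M 10 4 := by
  have hd : M.E.encard = M.eRank + ((5 : ℕ) + 6) := by
    rw [hR, ← M.ground_finite.cast_ncard_eq, hn]
    norm_num
  have h := ncard_fourCircuits_le_avgBound 5 M hfree hd hQ3 hQ4 hQ5
  rw [avgBound_values.2.2.2.2.1] at h
  exact c025_core_ten_eleven_of_cap M hR hn hfree h

end S1

end PercRepro
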